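import Mathlib
import Summits.AtomisticToContinuum.Crystallization.Theorems.ChessboardParticlePlanesLjLaminarWindowsPinnedGluingA
import HarnessLib

/-!
# Pinned gluing (S3 of line `stacking-blind-budget-flatness`), crux `ChessboardParticlePlanes.LjLaminarWindows`
(stmt-AtomisticToContinuum-6711): `stub_pinnedGluing`

**Statement.** For every separation `δ` and scale `(R, ε)` there are `η > 0` and `R'` such that: if every
particle within `R'` of particle `i` of a `δ`-separated finite configuration is crux-good and its 2-ball is
two-way `η`-matched (after a translation) with a rigid image of a PINNED box template (`InBox a z` and all
increments `z (m+1) - z m ≥ 19/25`, written INLINE), then the closed `R`-ball of `x i` is two-way `ε`-matched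
(after a translation) with ONE rigid image of ONE pinned box template.  Potential-free discrete geometry; `Good`
is only carried.  Pinned, centred twin of the PROVED `PrestressSplitKorn.stub_layeredGluing : LayeredGluing`
(tower `ReggeStarCoercivityDefectFreeCrystallizesLayeredGluing*.lean`, crux 13603).

**Proof** (= `layeredGluing_of_exactRigidity` with "pinned" and "centred" added).  By contradiction take
offending configurations for `η = 1/(n+1)`, `R' = n`, recentred at `x (i n)`; a subsequence converges in the
local matching topology to a `δ`-separated `Y ∋ 0` (`exists_subseq_forall_eventually_ballMatch`); every point
of `Y` is EXACTLY a rigid image of a PINNED box template on its open 2-ball (part A,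
`pinned_exactNear_of_limit`); hence `Y` is globally ONE rigid image of ONE PINNED box template
(`pinned_exactRigidity` below); read back at a large index, this is the forbidden window (centred, because the
recentred limit contains `0` and the matching is on balls about `0`).

**Exact pinned rigidity** (`pinned_exactRigidity`).  The global template `(A, t, a, s, Z)` of `Y` is the
tower's `exactLayeredRigidity_holds`; it remains to pin its increments `Z (m+1) - Z m`.  Transported to the
frame of the global template, `Y` is identity-framed (`FramedAt`) at the site of label `(m, 0, 0)` by the
re-based data `(s (· + m), Z (· + m) - Z m)`, and carries there a based template in some frame `E` with PINNED
heights (`pinned_templateAt`, the pinned twin of `exactNear_templateAt`, moved by `TemplateAt.map`).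
`pinned_z_one` is the dichotomy on `E`: if `E` tilts the vertical, the framing is cubic-ideal
(`gs_tilted_cubic`), so `Z (m+1) - Z m = √(2/3)·a ≥ √(2/3)·(47/50) ≥ 19/25` (`le_sqrt_two_thirds_mul`); if `E`
fixes the vertical up to sign, the up-site `(1, 0, 0)` of the framing is the image of a neighbour site of the
template (`exists_phi`), of template height `± z' (±1)`, which is pinned.
-/

noncomputable section

open scoped BigOperators Classical InnerProductSpace
open Filter Topology

namespace Summit.AtomisticToContinuum.Crystallization.Theorems.StackingBlindBudgetFlatness

open Literature.MathematicalPhysics.StatisticalMechanics Literature.Geometry.DiscreteGeometry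
open Summit.AtomisticToContinuum.Crystallization.Theorems.PrestressSplitKorn
open Summit.AtomisticToContinuum.Crystallization.Theorems.DefectFreeCrystallizes.Negative.PredicateAPI (Good)

/-! ## Numerics: the cubic spacing is pinned on the whole box -/

/-- `19/25 ≤ √(2/3)·a` for `a ≥ 47/50`: `(19/25)/(47/50) = 38/47` and `(38/47)² = 1444/2209 ≤ 2/3`. -/
theorem le_sqrt_two_thirds_mul {a : ℝ} (ha : 47 / 50 ≤ a) : 19 / 25 ≤ Real.sqrt (2 / 3) * a := by
  have h1 : (38 / 47 : ℝ) ≤ Real.sqrt (2 / 3) := by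
    rw [show (38 / 47 : ℝ) = Real.sqrt ((38 / 47) ^ 2) by rw [Real.sqrt_sq]; norm_num]
    exact Real.sqrt_le_sqrt (by norm_num)
  have h0 : (0 : ℝ) ≤ Real.sqrt (2 / 3) := Real.sqrt_nonneg _
  calc (19 / 25 : ℝ) = 38 / 47 * (47 / 50) := by norm_num
    _ ≤ Real.sqrt (2 / 3) * a := mul_le_mul h1 ha (by norm_num) h0

/-! ## Framings and based templates -/

/-- An identity framing is in particular a half-known identity-framed structure. -/
theorem halfFramedAt_of_framedAt {a : ℝ} {Y : Set (EuclideanSpace ℝ (Fin 3))} {q : EuclideanSpace ℝ (Fin 3)}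
    {s : ℤ → ℤ} {z : ℤ → ℝ} (h : FramedAt a Y q s z) : HalfFramedAt a Y q s z :=
  ⟨h.1, h.2.1, h.2.2.1, fun y hy hd _ => h.2.2.2.1 y hy hd, fun l hl _ => h.2.2.2.2 l hl⟩

/-- **Based PINNED template** (pinned twin of `exactNear_templateAt`): an exact pinned chart of the open
2-ball of a point `q ∈ Y` is re-based at `q` (label `0 ↦ q`, `z' 0 = 0`), keeping the pinned increments. -/
theorem pinned_templateAt {Y : Set (EuclideanSpace ℝ (Fin 3))} {q : EuclideanSpace ℝ (Fin 3)}
    (h : ∃ (A : EuclideanSpace ℝ (Fin 3) →ₗᵢ[ℝ] EuclideanSpace ℝ (Fin 3)) (t : EuclideanSpace ℝ (Fin 3)) (a : ℝ)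
        (s : ℤ → ℤ) (z : ℤ → ℝ), (InBox a z ∧ ∀ m : ℤ, 19 / 25 ≤ z (m + 1) - z m) ∧ IsHaggSeq s ∧
      (∀ y ∈ Y, dist y q < 2 → ∃ l, y + t = A (layeredPos a s z l)) ∧
      (∀ l, dist (A (layeredPos a s z l)) (q + t) < 2 → A (layeredPos a s z l) - t ∈ Y))
    (hq : q ∈ Y) :
    ∃ (E : EuclideanSpace ℝ (Fin 3) ≃ₗᵢ[ℝ] EuclideanSpace ℝ (Fin 3)) (a' : ℝ) (s' : ℤ → ℤ) (z' : ℤ → ℝ),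
      TemplateAt Y q E a' s' z' ∧ ∀ m : ℤ, 19 / 25 ≤ z' (m + 1) - z' m := by
  obtain ⟨A, t, a', s', z', ⟨hbox, hpin⟩, hs, h1, h2⟩ := h
  obtain ⟨l₀, hl₀⟩ := h1 q hq (by simp)
  set E : EuclideanSpace ℝ (Fin 3) ≃ₗᵢ[ℝ] EuclideanSpace ℝ (Fin 3) := A.toLinearIsometryEquiv rfl with hE
  have hEA : ∀ x, E x = A x := fun x => rfl
  refine ⟨E, a', fun k => s' (k + l₀.1), fun k => z' (k + l₀.1) - z' l₀.1,
    ⟨hbox.shift _, isHaggSeq_shift hs _, by simp, ?_, ?_⟩, fun m => ?_⟩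
  · intro y hy hd
    obtain ⟨l, hl⟩ := h1 y hy hd
    refine ⟨l - l₀, ?_⟩
    rw [hEA, layeredPos_shift, sub_add_cancel, map_sub, ← hl, ← hl₀]
    abel
  · intro l hl
    have key : A (layeredPos a' (fun k => s' (k + l₀.1)) (fun k => z' (k + l₀.1) - z' l₀.1) l) =
        A (layeredPos a' s' z' (l + l₀)) - (q + t) := by
      rw [layeredPos_shift, map_sub, hl₀]
    have hd : dist (A (layeredPos a' s' z' (l + l₀))) (q + t) < 2 := by
      rw [dist_eq_norm, ← key, LinearIsometry.norm_map]; exact hl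
    have := h2 (l + l₀) hd
    rw [hEA, key]
    convert this using 1
    abel
  · have h := hpin (m + l₀.1)
    rw [show m + l₀.1 + 1 = m + 1 + l₀.1 by ring] at h
    simp only
    linarith

/-! ## One increment, read through a pinned based template -/

/-- **Pinned reading of the first increment.** If `Y` is identity-framed at `q` by `(a, s, z)` and carries a
based template at `q` in a frame `E` with PINNED heights `z'`, then `19/25 ≤ z 1`.  Tilted frame: the framing is
cubic-ideal (`gs_tilted_cubic`), `z 1 = √(2/3)·a`; vertical frame: the up-site `(1, 0, 0)` of the framing is the
image of a neighbour site of the template (`exists_phi`), of height `± z' (±1)`. -/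
theorem pinned_z_one {a : ℝ} {Y : Set (EuclideanSpace ℝ (Fin 3))} {q : EuclideanSpace ℝ (Fin 3)} {s : ℤ → ℤ}
    {z : ℤ → ℝ} {E : EuclideanSpace ℝ (Fin 3) ≃ₗᵢ[ℝ] EuclideanSpace ℝ (Fin 3)} {a' : ℝ} {s' : ℤ → ℤ} {z' : ℤ → ℝ}
    (hF : FramedAt a Y q s z) (hT : TemplateAt Y q E a' s' z') (hpin : ∀ m : ℤ, 19 / 25 ≤ z' (m + 1) - z' m) :
    19 / 25 ≤ z 1 := by
  have hH : HalfFramedAt a Y q s z := halfFramedAt_of_framedAt hF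
  obtain ⟨hbox, -, hz0, -, -⟩ := hF
  by_cases hvert : E.symm (layerNormal 1) = layerNormal 1 ∨ E.symm (layerNormal 1) = -layerNormal 1
  · -- vertical frame: read the up-site through the label correspondence
    obtain ⟨φ, hφ, -, -⟩ := exists_phi hH hT
    obtain ⟨-, -, hz0', -, -⟩ := hT
    have hup0 : ((1 : ℤ), (0 : ℤ), (0 : ℤ)) ∈ upLabels (s 0) := by simp [upLabels]
    have hl0 : ((1 : ℤ), (0 : ℤ), (0 : ℤ)) ∈ nbrLabels s := mem_nbrLabels.2 (Or.inr (Or.inl hup0))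
    obtain ⟨hφl, he⟩ := hφ _ hl0
    have h2 := congrArg (fun x : EuclideanSpace ℝ (Fin 3) => x 2) he
    simp only [layeredPos_apply_two] at h2
    rw [inner_frame_two] at h2
    have hinner : ⟪layeredPos a' s' z' (φ (1, 0, 0)), layerNormal 1⟫_ℝ = z' (φ (1, 0, 0)).1 := by
      rw [real_inner_fin3]; simp [layerNormal]
    have hz1 := (hbox.z_one hz0).1
    have ha := hbox.a_pos
    have hk := nbrLabels_fst_le hφl
    have hz'1 : 19 / 25 ≤ z' 1 := by
      have := hpin 0; rwa [zero_add, hz0', sub_zero] at this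
    have hz'm1 : 19 / 25 ≤ -z' (-1) := by
      have := hpin (-1); rwa [neg_add_cancel, hz0', zero_sub] at this
    rcases hvert with hv | hv
    · rw [hv, hinner] at h2
      rcases (show (φ (1, 0, 0)).1 = -1 ∨ (φ (1, 0, 0)).1 = 0 ∨ (φ (1, 0, 0)).1 = 1 by omega) with h | h | h
      · rw [h] at h2; linarith
      · rw [h, hz0'] at h2; linarith
      · rw [h] at h2; linarith
    · rw [hv, inner_neg_right, hinner] at h2
      rcases (show (φ (1, 0, 0)).1 = -1 ∨ (φ (1, 0, 0)).1 = 0 ∨ (φ (1, 0, 0)).1 = 1 by omega) with h | h | h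
      · rw [h] at h2; linarith
      · rw [h, hz0'] at h2; linarith
      · rw [h] at h2; linarith
  · -- tilted frame: the framing is cubic-ideal at its base layer
    have hc := gs_tilted_cubic hH hT (not_or.1 hvert)
    rw [hc.2.1]
    exact le_sqrt_two_thirds_mul hbox.1

/-! ## Exact pinned rigidity -/

/-- **Exact PINNED local-to-global rigidity of box templates.** A nonempty uniformly discrete `Y ⊆ ℝ³` every
point of which is exactly a rigid image of a PINNED box template on its open 2-ball is globally ONE rigid image
of ONE PINNED box template. -/
theorem pinned_exactRigidity {Y : Set (EuclideanSpace ℝ (Fin 3))} (hne : Y.Nonempty) (hU : UniformlyDiscrete Y)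
    (hE : ∀ p ∈ Y, ∃ (A : EuclideanSpace ℝ (Fin 3) →ₗᵢ[ℝ] EuclideanSpace ℝ (Fin 3)) (t : EuclideanSpace ℝ (Fin 3))
        (a : ℝ) (s : ℤ → ℤ) (z : ℤ → ℝ), (InBox a z ∧ ∀ m : ℤ, 19 / 25 ≤ z (m + 1) - z m) ∧ IsHaggSeq s ∧
      (∀ y ∈ Y, dist y p < 2 → ∃ l, y + t = A (layeredPos a s z l)) ∧
      (∀ l, dist (A (layeredPos a s z l)) (p + t) < 2 → A (layeredPos a s z l) - t ∈ Y)) :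
    ∃ (A : EuclideanSpace ℝ (Fin 3) →ₗᵢ[ℝ] EuclideanSpace ℝ (Fin 3)) (t : EuclideanSpace ℝ (Fin 3)) (a : ℝ)
        (s : ℤ → ℤ) (z : ℤ → ℝ), (InBox a z ∧ ∀ m : ℤ, 19 / 25 ≤ z (m + 1) - z m) ∧ IsHaggSeq s ∧
      Y = {y | ∃ l, y + t = A (layeredPos a s z l)} := by
  have hE' : ∀ p ∈ Y, ExactNear Y p := fun p hp => by
    obtain ⟨A, t, a, s, z, hbox, hs, h1, h2⟩ := hE p hp
    exact ⟨A, t, a, s, z, hbox.1, hs, h1, h2⟩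
  obtain ⟨A, t, a, s, Z, hbox, hs, hYeq⟩ := exactLayeredRigidity_holds Y hne hU hE'
  refine ⟨A, t, a, s, Z, ⟨hbox, fun m => ?_⟩, hs, hYeq⟩
  -- the point of label `(m, 0, 0)` and its pinned based template
  set q : EuclideanSpace ℝ (Fin 3) := A (layeredPos a s Z (m, 0, 0)) - t with hq
  have hqY : q ∈ Y := by rw [hYeq]; exact ⟨(m, 0, 0), by rw [hq, sub_add_cancel]⟩
  obtain ⟨E', a', s', z', hT, hpin⟩ := pinned_templateAt (hE q hqY) hqY
  -- transport to the frame of the global template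
  set E : EuclideanSpace ℝ (Fin 3) ≃ₗᵢ[ℝ] EuclideanSpace ℝ (Fin 3) := A.toLinearIsometryEquiv rfl with hEdef
  have hEA : ∀ x, E x = A x := fun x => rfl
  have hT' := hT.map E.symm (E.symm t)
  have hq' : E.symm q + E.symm t = layeredPos a s Z (m, 0, 0) := by
    rw [← (map_add E.symm q t), hq, sub_add_cancel, ← hEA, LinearIsometryEquiv.symm_apply_apply]
  rw [hq'] at hT'
  -- the transported set is identity-framed at `layeredPos a s Z (m, 0, 0)` by the re-based data
  have hsh : ∀ l, layeredPos a (fun k => s (k + m)) (fun k => Z (k + m) - Z m) l =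
      layeredPos a s Z (l + (m, 0, 0)) - layeredPos a s Z (m, 0, 0) :=
    fun l => layeredPos_shift a s Z (m, 0, 0) l
  have hF : FramedAt a ((fun y => E.symm y + E.symm t) '' Y) (layeredPos a s Z (m, 0, 0))
      (fun k => s (k + m)) (fun k => Z (k + m) - Z m) := by
    refine ⟨hbox.shift m, isHaggSeq_shift hs m, by simp, ?_, ?_⟩
    · rintro _ ⟨y, hy, rfl⟩ -
      rw [hYeq] at hy
      obtain ⟨l₀, hl₀⟩ := hy
      refine ⟨l₀ - (m, 0, 0), ?_⟩
      show E.symm y + E.symm t = _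
      rw [← (map_add E.symm y t), hl₀, ← hEA, LinearIsometryEquiv.symm_apply_apply, hsh, sub_add_cancel]
      abel
    · rintro l -
      refine ⟨A (layeredPos a s Z (l + (m, 0, 0))) - t, ?_, ?_⟩
      · rw [hYeq]; exact ⟨l + (m, 0, 0), by rw [sub_add_cancel]⟩
      · show E.symm (A (layeredPos a s Z (l + (m, 0, 0))) - t) + E.symm t = _
        rw [map_sub, sub_add_cancel, ← hEA, LinearIsometryEquiv.symm_apply_apply, hsh]
        abel
  have h1 := pinned_z_one hF hT' hpin
  rwa [add_comm] at h1

/-- **S3 — PINNED GLUING** (registered stub `stub_pinnedGluing` of crux stmt-AtomisticToContinuum-6711, line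
`stacking-blind-budget-flatness`).  For every separation `δ` and scale `(R, ε)` there are `η > 0` and `R'` such
that: if every particle within `R'` of particle `i` of a `δ`-separated finite configuration is crux-good and its
`2`-ball is two-way `η`-matched (after a translation) with a rigid image of a PINNED box template, then the closed
`R`-ball of `x i` is two-way `ε`-matched (after a translation) with ONE rigid image of ONE pinned box template.
Compactness in the local matching topology (part A) plus exact pinned rigidity (`pinned_exactRigidity`). -/
theorem stub_pinnedGluing :
    ∀ δ : ℝ, 0 < δ → ∀ R ε : ℝ, 0 < ε → ∃ η : ℝ, 0 < η ∧ ∃ R' : ℝ,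
      ∀ (N : ℕ) (x : Fin N → EuclideanSpace ℝ (Fin 3)), (∀ i j : Fin N, i ≠ j → δ ≤ dist (x i) (x j)) →
      ∀ i : Fin N,
        (∀ j : Fin N, dist (x j) (x i) ≤ R' → Good x j ∧
          ∃ (A : EuclideanSpace ℝ (Fin 3) →ₗᵢ[ℝ] EuclideanSpace ℝ (Fin 3)) (t : EuclideanSpace ℝ (Fin 3))
              (a : ℝ) (s : ℤ → ℤ) (z : ℤ → ℝ),
            (InBox a z ∧ ∀ m : ℤ, 19 / 25 ≤ z (m + 1) - z m) ∧ IsHaggSeq s ∧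
            (∀ k : Fin N, dist (x k) (x j) ≤ 2 →
              ∃ l : ℤ × ℤ × ℤ, dist (x k + t) (A (layeredPos a s z l)) ≤ η) ∧
            (∀ l : ℤ × ℤ × ℤ, dist (A (layeredPos a s z l)) (x j + t) ≤ 2 →
              ∃ k : Fin N, dist (x k + t) (A (layeredPos a s z l)) ≤ η)) →
        ∃ (A : EuclideanSpace ℝ (Fin 3) →ₗᵢ[ℝ] EuclideanSpace ℝ (Fin 3)) (t : EuclideanSpace ℝ (Fin 3))
            (a : ℝ) (s : ℤ → ℤ) (z : ℤ → ℝ),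
          (InBox a z ∧ ∀ m : ℤ, 19 / 25 ≤ z (m + 1) - z m) ∧ IsHaggSeq s ∧
          (∀ j : Fin N, dist (x j) (x i) ≤ R →
            ∃ l : ℤ × ℤ × ℤ, dist (x j + t) (A (layeredPos a s z l)) ≤ ε) ∧
          (∀ l : ℤ × ℤ × ℤ, dist (A (layeredPos a s z l)) (x i + t) ≤ R →
            ∃ j : Fin N, dist (x j + t) (A (layeredPos a s z l)) ≤ ε) := by
  intro δ hδ R ε hε
  by_contra H
  -- offending configurations for `η = 1/(n+1)`, `R' = n`
  have key : ∀ n : ℕ, ∃ (N : ℕ) (x : Fin N → EuclideanSpace ℝ (Fin 3)) (i : Fin N),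
      (∀ i j : Fin N, i ≠ j → δ ≤ dist (x i) (x j)) ∧
      (∀ j : Fin N, dist (x j) (x i) ≤ n → Good x j ∧
          ∃ (A : EuclideanSpace ℝ (Fin 3) →ₗᵢ[ℝ] EuclideanSpace ℝ (Fin 3)) (t : EuclideanSpace ℝ (Fin 3))
              (a : ℝ) (s : ℤ → ℤ) (z : ℤ → ℝ),
            (InBox a z ∧ ∀ m : ℤ, 19 / 25 ≤ z (m + 1) - z m) ∧ IsHaggSeq s ∧
            (∀ k : Fin N, dist (x k) (x j) ≤ 2 →
              ∃ l : ℤ × ℤ × ℤ, dist (x k + t) (A (layeredPos a s z l)) ≤ 1 / ((n : ℝ) + 1)) ∧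
            (∀ l : ℤ × ℤ × ℤ, dist (A (layeredPos a s z l)) (x j + t) ≤ 2 →
              ∃ k : Fin N, dist (x k + t) (A (layeredPos a s z l)) ≤ 1 / ((n : ℝ) + 1))) ∧
      ¬ ∃ (A : EuclideanSpace ℝ (Fin 3) →ₗᵢ[ℝ] EuclideanSpace ℝ (Fin 3)) (t : EuclideanSpace ℝ (Fin 3))
            (a : ℝ) (s : ℤ → ℤ) (z : ℤ → ℝ),
          (InBox a z ∧ ∀ m : ℤ, 19 / 25 ≤ z (m + 1) - z m) ∧ IsHaggSeq s ∧
          (∀ j : Fin N, dist (x j) (x i) ≤ R →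
            ∃ l : ℤ × ℤ × ℤ, dist (x j + t) (A (layeredPos a s z l)) ≤ ε) ∧
          (∀ l : ℤ × ℤ × ℤ, dist (A (layeredPos a s z l)) (x i + t) ≤ R →
            ∃ j : Fin N, dist (x j + t) (A (layeredPos a s z l)) ≤ ε) := by
    intro n
    by_contra hn
    refine H ⟨1 / ((n : ℝ) + 1), by positivity, n, fun N x hsep i hi => ?_⟩
    by_contra hc
    exact hn ⟨N, x, i, hsep, hi, hc⟩
  choose N x i hsep hloc hbad using key
  -- recentred particle sets
  set Ys : ℕ → Set (EuclideanSpace ℝ (Fin 3)) := fun n => Set.range fun j => x n j - x n (i n) with hYs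
  have hYsep : ∀ n, ∀ p ∈ Ys n, ∀ q ∈ Ys n, p ≠ q → δ ≤ dist p q := by
    rintro n _ ⟨j, rfl⟩ _ ⟨j', rfl⟩ hne
    rw [dist_sub_right]
    exact hsep n j j' fun h => hne (by rw [h])
  obtain ⟨φ, Y, hφ, hYsep', hmatch⟩ := exists_subseq_forall_eventually_ballMatch hδ Ys hYsep
  have hφt : Tendsto φ atTop atTop := hφ.tendsto_atTop
  have hfin : ∀ w : EuclideanSpace ℝ (Fin 3), (Y ∩ Metric.closedBall w 1).Finite := fun w =>
    finite_of_forall_le_dist_of_subset_closedBall hδ (fun p hp q hq => hYsep' p hp.1 q hq.1)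
      Set.inter_subset_right
  -- `0 ∈ Y`: the window will be centred
  have h0 : (0 : EuclideanSpace ℝ (Fin 3)) ∈ Y := by
    apply mem_of_forall_exists_dist_le (hfin 0)
    intro γ hγ
    obtain ⟨k, hk⟩ := (hmatch 1 γ hγ).exists
    obtain ⟨y, hy, hd⟩ := hk.2 0 ⟨i (φ k), by simp⟩ (by simp)
    exact ⟨y, hy, by rwa [dist_comm]⟩
  -- every point of `Y` is exactly a rigid image of a pinned box template on its open 2-ball
  have hloc' : ∀ k, ∀ q ∈ Ys (φ k), ‖q‖ ≤ (φ k : ℝ) →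
      ∃ (A : EuclideanSpace ℝ (Fin 3) →ₗᵢ[ℝ] EuclideanSpace ℝ (Fin 3)) (t : EuclideanSpace ℝ (Fin 3)) (a : ℝ)
          (s : ℤ → ℤ) (z : ℤ → ℝ), (InBox a z ∧ ∀ m : ℤ, 19 / 25 ≤ z (m + 1) - z m) ∧ IsHaggSeq s ∧
        (∀ y ∈ Ys (φ k), dist y q ≤ 2 → ∃ l, dist (y + t) (A (layeredPos a s z l)) ≤ 1 / ((φ k : ℝ) + 1)) ∧
        (∀ l, dist (A (layeredPos a s z l)) (q + t) ≤ 2 →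
          ∃ y ∈ Ys (φ k), dist (y + t) (A (layeredPos a s z l)) ≤ 1 / ((φ k : ℝ) + 1)) := by
    rintro k _ ⟨j, rfl⟩ hj
    have h := (hloc (φ k) j (by rwa [dist_eq_norm])).2
    exact pinned_setChart_of_particleChart h
  have hexact := fun p (hp : p ∈ Y) =>
    pinned_exactNear_of_limit hδ hYsep' (fun ρ γ hγ => hmatch ρ γ hγ)
      (tendsto_one_div_add_atTop_nhds_zero_nat.comp hφt)
      (tendsto_natCast_atTop_atTop.comp hφt) hloc' hp
  -- the global pinned template and the contradiction
  obtain ⟨A, t, a, s, z, hbox, hs, hYeq⟩ := pinned_exactRigidity ⟨0, h0⟩ ⟨δ, hδ, hYsep'⟩ hexact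
  obtain ⟨k, hk⟩ := (hmatch R (ε / 2) (half_pos hε)).exists
  refine hbad (φ k) ⟨A, t - x (φ k) (i (φ k)), a, s, z, hbox, hs, ?_, ?_⟩
  · -- particles of the closed `R`-ball of `x i` are matched
    intro j hj
    obtain ⟨y, hy, hd⟩ := hk.2 _ ⟨j, rfl⟩ (by rwa [dist_zero_right, ← dist_eq_norm])
    rw [hYeq] at hy
    obtain ⟨l, hl⟩ := hy
    refine ⟨l, ?_⟩
    calc dist (x (φ k) j + (t - x (φ k) (i (φ k)))) (A (layeredPos a s z l))
        = dist (x (φ k) j - x (φ k) (i (φ k))) y := by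
          rw [← hl, dist_eq_norm, dist_eq_norm]; congr 1; abel
      _ ≤ ε / 2 := hd
      _ ≤ ε := by linarith
  · -- template points of the closed `R`-ball of `x i + (t - x i) = t` are matched
    intro l hl
    have ht : x (φ k) (i (φ k)) + (t - x (φ k) (i (φ k))) = t := by abel
    rw [ht] at hl
    have hy : A (layeredPos a s z l) - t ∈ Y := by rw [hYeq]; exact ⟨l, by rw [sub_add_cancel]⟩
    obtain ⟨q, ⟨j, rfl⟩, hq⟩ := hk.1 _ hy (by rwa [dist_zero_right, ← dist_eq_norm])
    refine ⟨j, ?_⟩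
    calc dist (x (φ k) j + (t - x (φ k) (i (φ k)))) (A (layeredPos a s z l))
        = dist (x (φ k) j - x (φ k) (i (φ k))) (A (layeredPos a s z l) - t) := by
          rw [dist_eq_norm, dist_eq_norm]; congr 1; abel
      _ ≤ ε / 2 := hq
      _ ≤ ε := by linarith

end Summit.AtomisticToContinuum.Crystallization.Theorems.StackingBlindBudgetFlatness

end
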